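import Summits.ValiantsHypothesis.ValiantsHypothesis.Theorems.FeketeSOSFeketeSOSHardPaleyRIPSmallSetEquiv
import Summits.ValiantsHypothesis.ValiantsHypothesis.Theorems.FeketeSOSFeketeSOSHardPaleyRIPNormFloor
import Summits.ValiantsHypothesis.ValiantsHypothesis.Theorems.FeketeSOSFeketeSOSHardPaleyRIPTradeoff

/-!
# Route FeketeSOS — crux `FeketeSOSHard` (stmt-ValiantsHypothesis-3996), line `paley-rip`:
# the line as a CONDITIONAL BRIDGE on the Paley graph conjecture, and its tameness window

Two packaging theorems that state, in kernel, what the line of record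
`Cruxes/FeketeSOSHard/Lines/paley_rip_v3.lean` delivers and what it cannot:

* `feketeSOSHard_of_paleyGraphProperty_of_tameOperator` — **the bridge**: if the Paley graph property
  `𝒫(α, β)` of Chor–Goldreich 1988 / Chung 1994 holds for SOME `α < 1/2` (power-saving discrepancy
  `|Σ_{a∈A,b∈B} χ_p(a−b)| ≤ (#A·#B)^{1−β/2}` for all large `p` and all `A, B ⊆ [0,p)` of size `≥ p^α` — the
  "Paley graph conjecture just below the `1/2` barrier", OPEN), and operator tameness `T(r,m)` holds
  (`stub_tameOperator`, verbatim: exponent `1 + ε` for every `ε > 0`), then `FeketeSOSHard`.  Proof: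
  `𝒫 ⇒ engine` (`flatRIP_iff_smallSetDiffDiscrepancy`, this seat) and the trade-off composition
  `feketeSOSHard_of_flatRIP_of_tameOperator_gamma` (seat val-width-3996-p2) at `γ = 1 + κ`.  So the line
  is exactly a conditional bridge `PaleyGraphConjecture(<1/2) ∧ Tameness ⇒ X`; neither hypothesis is a
  theorem.
* `tameness_exponent_lt_of_flatRIP` — **the window**: the trade-off composition needs `κ > (γ−1)/2`, and
  the norm floor (`kappa_add_half_delta_le_quarter_of_flatRIP`) caps every admissible engine exponent at
  `κ ≤ 1/4 − δ₁/2`; hence any instance of the composition has tameness exponent `γ < 3/2 − δ₁ < 3/2`.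
  The unconditional tameness exponents in the tree (`2`, spreading; `3/2` claimed trivial in the v3
  docstring) can therefore NEVER be paired with a true engine: a genuine power saving in tameness is
  necessary, whatever the truth about Paley graphs — and, under the strongest conjecturable engine
  (`κ ↑ 1/4 − δ₁/2`, random-matrix flatness), ANY `γ < 3/2 − δ₁` would suffice.

Honest framing: a conditional implication and a necessary condition; the crux `FeketeSOSHard`, the
engine (= Paley graph conjecture below `1/2`) and `stub_tameOperator` remain OPEN; nothing here bears on
`VP ≠ VNP`.
-/

-- the line's namespace repeats a path segment by convention (same as the other paley-rip files)
set_option linter.dupNamespace false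

namespace Summit.ValiantsHypothesis.ValiantsHypothesis.Theorems.FeketeSOSHardPaleyRIP

open Polynomial Finset
open scoped BigOperators
open Summit.ValiantsHypothesis.ValiantsHypothesis.Theses

noncomputable section

section Bridge

/-- **`FeketeSOSHard` ⟸ Paley graph property `𝒫(α,β)` for some `α < 1/2` ∧ operator tameness.**
The first hypothesis is the Chor–Goldreich / Chung small-set discrepancy of the Paley graph below the
`1/2` barrier (difference form, power saving `(#A·#B)^{−β/2}`), the second is `stub_tameOperator` of the
registered skeleton verbatim.  [folklore] -/
theorem feketeSOSHard_of_paleyGraphProperty_of_tameOperator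
    (hP : ∃ α : ℝ, α < 1 / 2 ∧ ∃ β : ℝ, 0 < β ∧ ∃ p₁ : ℕ, ∀ (p : ℕ) [Fact p.Prime], p₁ ≤ p →
      ∀ (A B : Finset ℕ), (∀ a ∈ A, a < p) → (∀ b ∈ B, b < p) →
        (p : ℝ) ^ α ≤ (A.card : ℝ) → (p : ℝ) ^ α ≤ (B.card : ℝ) →
        ‖∑ a ∈ A, ∑ b ∈ B, ((legendreSym p ((a : ℤ) - b) : ℤ) : ℂ)‖ ≤
          ((A.card : ℝ) * B.card) ^ (1 - β / 2))
    (hT : ∀ ε : ℝ, 0 < ε → ∃ K : ℝ, 0 < K ∧ ∀ (p : ℕ) [Fact p.Prime] (r : ℕ) (S : Finset ℕ),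
      (∀ a ∈ S, a < p) → ∀ (c : Fin r → ℂ) (w : Fin r → ℂ[X]), (∀ i, (w i).support ⊆ S) →
      ∀ (F : ℂ[X]) (M : ℝ), F.natDegree < p → ((X : ℂ[X]) ^ p - 1 ∣ (∑ i, C (c i) * w i ^ 2) - F) →
        (∀ n, ‖F.coeff n‖ ≤ M) →
        ∃ (s' : ℕ) (c' : Fin s' → ℂ) (w' : Fin s' → ℂ[X]), (∀ j, (w' j).support ⊆ S) ∧
          ((X : ℂ[X]) ^ p - 1 ∣ (∑ j, C (c' j) * w' j ^ 2) - F) ∧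
          (∑ j, sqMass (c' j) (w' j)) ≤ K * (r : ℝ) ^ K * (S.card : ℝ) ^ (1 + ε) * M) :
    FeketeSOS.FeketeSOSHard := by
  obtain ⟨κ, hκ, δ₁, hδ₁, p₁, hB⟩ := flatRIP_iff_smallSetDiffDiscrepancy.2 hP
  obtain ⟨K, hK, hTκ⟩ := hT κ hκ
  exact feketeSOSHard_of_flatRIP_of_tameOperator_gamma κ δ₁ (1 + κ) K hδ₁ (by linarith) hK
    (by linarith) ⟨p₁, hB⟩ (fun p _ r S hS c w hw F M hF hdvd hM => hTκ p r S hS c w hw F M hF hdvd hM)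

/-- **The tameness window of the line.**  If the engine's inequality holds with exponents `(κ, δ₁)`,
`κ, δ₁ > 0`, at all large primes, and `(γ − 1)/2 < κ` (the hypothesis under which the trade-off
composition `feketeSOSHard_of_flatRIP_of_tameOperator_gamma` fires with tameness exponent `γ`), then
`γ < 3/2 − δ₁`: by the norm floor `κ ≤ 1/4 − δ₁/2`.  In particular no true engine pairs with the
unconditional tameness exponents `≥ 3/2`. [folklore] -/
theorem tameness_exponent_lt_of_flatRIP (κ δ₁ γ : ℝ) (hκ : 0 < κ) (hδ₁ : 0 < δ₁)
    (hgap : (γ - 1) / 2 < κ)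
    (hB : ∃ p₁ : ℕ, ∀ (p : ℕ) [Fact p.Prime], p₁ ≤ p →
      ∀ (S : Finset ℕ), (∀ a ∈ S, a < p) → (S.card : ℝ) ≤ (p : ℝ) ^ (1 / 2 + δ₁) →
      ∀ (w : ℕ → ℂ), ‖paleyForm p S w‖ ≤ (p : ℝ) ^ (1 / 2 - κ) * ∑ a ∈ S, ‖w a‖ ^ 2) :
    γ < 3 / 2 - δ₁ := by
  obtain ⟨p₁, hB⟩ := hB
  have h := kappa_add_half_delta_le_quarter_of_flatRIP κ δ₁ hκ hδ₁ p₁ hB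
  linarith

/-- The same window read off the registered `∃`-statement of `stub_paleyFlatRIP`: whatever pair it
provides, the paired tameness exponent is `< 3/2` (indeed `< 3/2 − δ₁`). [folklore] -/
theorem tameness_exponent_lt_three_halves
    (hB : ∃ κ : ℝ, 0 < κ ∧ ∃ δ₁ : ℝ, 0 < δ₁ ∧ ∃ p₁ : ℕ, ∀ (p : ℕ) [Fact p.Prime], p₁ ≤ p →
      ∀ (S : Finset ℕ), (∀ a ∈ S, a < p) → (S.card : ℝ) ≤ (p : ℝ) ^ (1 / 2 + δ₁) →
      ∀ (w : ℕ → ℂ), ‖paleyForm p S w‖ ≤ (p : ℝ) ^ (1 / 2 - κ) * ∑ a ∈ S, ‖w a‖ ^ 2) :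
    ∃ κ : ℝ, 0 < κ ∧ κ < 1 / 4 ∧ ∀ γ : ℝ, (γ - 1) / 2 < κ → γ < 3 / 2 := by
  obtain ⟨κ, hκ, δ₁, hδ₁, p₁, hB⟩ := hB
  have h := kappa_add_half_delta_le_quarter_of_flatRIP κ δ₁ hκ hδ₁ p₁ hB
  exact ⟨κ, hκ, by linarith, fun γ hγ => by linarith⟩

end Bridge

end

end Summit.ValiantsHypothesis.ValiantsHypothesis.Theorems.FeketeSOSHardPaleyRIP
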